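import Summits.HodgeConjecture.CorCM.Census.CentralSquaresPartnersLaw
import Summits.HodgeConjecture.CorCM.Census.CentralSquaresPartnersFar

/-!
# The square-central class, LIX: the all-dihedral multi-partner law from INTERSECTION COUNTS

COR-CM (cell `pub-hodgecm2`), count-neutral kernel combinatorics by the binder seat b09 (gen 50; lane SQUARE-CENTRAL CLASS, part LIX), on part LVI
(`isLeast_card_gfaces_generate_partners_dihedral`), part LVII (`tie_of_inter_bounds`, `tieC_of_inter_bounds`), part LVIII (`far_of_inter_bounds`), part VI
(`card_frame`), part VII (`companion_card`) and part III (`ddist_eq_card_symmDiff`, `ddist_compl_eq`), BY NAME.  Theorems only: no definition, no `decide`,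
no certificate, no named fact, no `sorry`.  HONEST FRAMING: `HC_CM` is NOT proved, here or anywhere in the tree; nothing here is a period or a headline.

**THE COUNT FORM OF THE ALL-DIHEDRAL MULTI-PARTNER LAW (`isLeast_card_gfaces_generate_partners_dihedral_of_counts`).**  The tie and far-partner
hypotheses of part LVI are replaced by INTERSECTION COUNTS, which is what a concrete model computes: for each partner `T₁` (swap `Q`, transversals
`T ⊆ 𝓗`, `T' ⊆ T₀ ∩ T₁`) and every other partner `T₂` (`𝓗₂ = T₀ ∖ T₂`):
every transversal of `𝓗` and of `T₀ ∩ T₁` meets `𝓗₂` in `1 … m−1` places (ties); `T`, `T'` meet `𝓗₂` in `3 … m−3` places, and so do their exchanged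
images `c·(𝓗 ∖ T) ⊆ T₁ ∖ T₀` with `T₁ ∖ T₂` and `c·((T₀ ∩ T₁) ∖ T') ⊆ T̄₁ ∖ T₀` with `T̄₁ ∖ T₂` (far partners).  Then **`μ(G, c) = φ₂(G, c)`**.
In the rank-two affine block of `2^{1+4}_+ × E` every one of these counts is `m/2` (numerics `lean-g50/py/eight3.py` at `m = 4`), so the law applies as soon
as `m ≥ 8`, i.e. `|E| ≥ 2`; the instance is the successorʼs file.

## References
* [Pohlmann1968] H. Pohlmann, Algebraic cycles on abelian varieties of complex multiplication type, Ann. of Math. 88 (1968), Thm 1.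
* [Milne1999] J. S. Milne, Lefschetz motives and the Tate conjecture, Compositio Math. 117 (1999), Prop. 2.1, p. 54.
-/

namespace Summit.HodgeConjecture.CorCM.Census.CentralSquares

open Finset
open scoped symmDiff
open Summit.HodgeConjecture.CorCM.Prior.AllgGroup.RfwfAllgGroup
open Summit.HodgeConjecture.CorCM.Census.BlockParity
open Summit.HodgeConjecture.CorCM.Census.Coinvariant
open Summit.HodgeConjecture.CorCM.Census.TwistGeneration
open Summit.HodgeConjecture.CorCM.Census.BaseBlock
open Summit.HodgeConjecture.CorCM.Census.CoverClosure

noncomputable section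

variable {G : Type*} [Group G] [Fintype G] [DecidableEq G] (c : G)

/-- **THE ALL-DIHEDRAL MULTI-PARTNER LAW, COUNT FORM.**  As part LVIʼs law, with the tie and far-partner hypotheses replaced by intersection counts with
the other partnersʼ sets `𝓗₂ = T₀ ∖ T₂` (and `T₁ ∖ T₂`, `T̄₁ ∖ T₂` for the exchanged classes).  Then **`μ(G, c) = φ₂(G, c)`**. [folklore] -/
theorem isLeast_card_gfaces_generate_partners_dihedral_of_counts (hG : IsPGroup 2 G) (hc2 : c * c = 1) (hc1 : c ≠ 1)
    (hcen : ∀ x : G, x * c = c * x) (T₀ : CMF G c) (𝒯 : Finset (CMF G c)) (h𝒯 : 𝒯.Nonempty)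
    (hbase : ∀ Q : G, rt c Q T₀ = T₀ ∨ rt c Q T₀ = rt c c T₀ ∨ ∃ T₁ ∈ 𝒯, rt c Q T₀ = T₁ ∨ rt c Q T₀ = rt c c T₁)
    (m : ℕ) (hm : 3 ≤ m) (hn : T₀.1.card = 4 * m) (hH : ∀ T₁ ∈ 𝒯, (T₀.1 \ T₁.1).card = 2 * m)
    (hpair : ∀ T₁ ∈ 𝒯, ∀ T₂ ∈ 𝒯, T₁ ≠ T₂ → ((T₀.1 \ T₁.1) ∆ (T₀.1 \ T₂.1)).card = 2 * m)
    (hframe : ∀ T₁ ∈ 𝒯, ∃ Q : G, ∃ T T' : Finset G,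
      rt c Q T₀ = T₁ ∧ Q * Q = 1 ∧
      (∀ t ∈ T₀.1, ∀ t' ∈ T₀.1, (t' = t * Q ∨ t' = c * (t * Q)) → (t ∈ T₀.1 \ T₁.1 ↔ t' ∈ T₀.1 \ T₁.1)) ∧
      (T ⊆ T₀.1 \ T₁.1 ∧ T.card = m ∧ ∀ t ∈ T₀.1 \ T₁.1, ∀ t' ∈ T₀.1, (t' = t * Q ∨ t' = c * (t * Q)) → (t ∈ T ↔ t' ∉ T)) ∧
      (T' ⊆ T₀.1 ∩ T₁.1 ∧ T'.card = m ∧ ∀ t ∈ T₀.1 ∩ T₁.1, ∀ t' ∈ T₀.1, (t' = t * Q ∨ t' = c * (t * Q)) → (t ∈ T' ↔ t' ∉ T')) ∧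
      -- ties: every transversal of `𝓗` and of `T₀ ∩ T₁` meets every other `𝓗₂` in `1 … m−1` places
      (∀ U : Finset G, U ⊆ T₀.1 \ T₁.1 → U.card = m →
        (∀ t ∈ T₀.1 \ T₁.1, ∀ t' ∈ T₀.1, (t' = t * Q ∨ t' = c * (t * Q)) → (t ∈ U ↔ t' ∉ U)) →
        ∀ T₂ ∈ 𝒯, T₂ ≠ T₁ → 0 < (U ∩ (T₀.1 \ T₂.1)).card ∧ (U ∩ (T₀.1 \ T₂.1)).card < m) ∧
      (∀ U' : Finset G, U' ⊆ T₀.1 ∩ T₁.1 → U'.card = m →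
        (∀ t ∈ T₀.1 ∩ T₁.1, ∀ t' ∈ T₀.1, (t' = t * Q ∨ t' = c * (t * Q)) → (t ∈ U' ↔ t' ∉ U')) →
        ∀ T₂ ∈ 𝒯, T₂ ≠ T₁ → 0 < (U' ∩ (T₀.1 \ T₂.1)).card ∧ (U' ∩ (T₀.1 \ T₂.1)).card < m) ∧
      -- far partners: `T`, `T'` and their exchanged images meet the other partners' sets in `3 … m−3` places
      (∀ T₂ ∈ 𝒯, T₂ ≠ T₁ →
        (3 ≤ (T ∩ (T₀.1 \ T₂.1)).card ∧ (T ∩ (T₀.1 \ T₂.1)).card + 3 ≤ m) ∧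
        (3 ≤ (((T₀.1 \ T₁.1) \ T).image (fun x => c * x) ∩ (T₁.1 \ T₂.1)).card ∧
          (((T₀.1 \ T₁.1) \ T).image (fun x => c * x) ∩ (T₁.1 \ T₂.1)).card + 3 ≤ m) ∧
        (3 ≤ (T' ∩ (T₀.1 \ T₂.1)).card ∧ (T' ∩ (T₀.1 \ T₂.1)).card + 3 ≤ m) ∧
        (3 ≤ (((T₀.1 \ (rt c c T₁).1) \ T').image (fun x => c * x) ∩ ((rt c c T₁).1 \ T₂.1)).card ∧
          (((T₀.1 \ (rt c c T₁).1) \ T').image (fun x => c * x) ∩ ((rt c c T₁).1 \ T₂.1)).card + 3 ≤ m))) :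
    IsLeast {n : ℕ | ∃ S : Finset (CMF G c →₀ ℤ), (↑S ⊆ gfaceSet G c hc2) ∧ S.card = n ∧
      hodgeSpan c hc2 ≤ Submodule.span ℤ (pairSet c) ⊔ Submodule.span ℤ (translates c S)} (fibreTwo c hc2) := by
  refine isLeast_card_gfaces_generate_partners_dihedral c hG hc2 hc1 hcen T₀ 𝒯 h𝒯 hbase m hm hn hH hpair fun T₁ hT₁ => ?_
  obtain ⟨Q, T, T', hQ, hQQ, hσH, ⟨hTH, hTm, hT⟩, ⟨hTH', hTm', hT'⟩, hcU, hcU', hcfar⟩ := hframe T₁ hT₁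
  have hm1 : 1 ≤ m := by omega
  -- cardinalities in the exchanged and companion frames
  have hn₁ : T₁.1.card = 4 * m := card_frame c hc2 T₀ T₁ m hn
  have hn₁c : (rt c c T₁).1.card = 4 * m := card_frame c hc2 T₀ (rt c c T₁) m hn
  have hH₁ : ∀ T₂ ∈ 𝒯, T₂ ≠ T₁ → (T₁.1 \ T₂.1).card = 2 * m := by
    intro T₂ hT₂ h12
    have e : (T₁.1 \ T₂.1).card = ddist T₁ T₂ := rfl
    rw [e, ddist_eq_card_symmDiff c T₀ hc2 T₁ T₂]
    exact hpair T₁ hT₁ T₂ hT₂ (Ne.symm h12)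
  have hH₁c : ∀ T₂ ∈ 𝒯, T₂ ≠ T₁ → ((rt c c T₁).1 \ T₂.1).card = 2 * m := by
    intro T₂ hT₂ h12
    have e : ((rt c c T₁).1 \ T₂.1).card = ddist (rt c c T₁) T₂ := rfl
    rw [e, ddist_compl_eq c T₀ hc2 hcen T₁ T₂, hn, hpair T₁ hT₁ T₂ hT₂ (Ne.symm h12)]
    omega
  have hcW : (((T₀.1 \ T₁.1) \ T).image (fun x => c * x)).card = m := by
    rw [card_image_of_injective _ (mul_right_injective c), card_sdiff_of_subset hTH, hH T₁ hT₁, hTm]; omega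
  have hHcEq : T₀.1 \ (rt c c T₁).1 = T₀.1 ∩ T₁.1 := by
    rw [dev_compl c hcen T₀ T₁]; ext t; simp only [mem_sdiff, mem_inter, not_and, not_not]; tauto
  have hcW' : (((T₀.1 \ (rt c c T₁).1) \ T').image (fun x => c * x)).card = m := by
    rw [card_image_of_injective _ (mul_right_injective c), hHcEq, card_sdiff_of_subset hTH']
    have h0 := card_sdiff_add_card_inter T₀.1 T₁.1
    have h1 := hH T₁ hT₁
    omega
  refine ⟨Q, T, T', hQ, hQQ, hσH, ⟨hTH, hTm, hT⟩, ⟨hTH', hTm', hT'⟩, ?_, ?_, ?_, ?_⟩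
  · -- ties on `𝓗`
    intro U hUH hUm hU
    exact tie_of_inter_bounds c T₀ 𝒯 hbase m hn hH hc2 hcen hm1 hT₁ U hUH hUm (hcU U hUH hUm hU)
  · -- ties on `T₀ ∩ T₁`
    intro U' hUH hUm hU
    exact tieC_of_inter_bounds c T₀ 𝒯 hbase m hn hH hc2 hcen hm1 hT₁ U' hUH hUm (hcU' U' hUH hUm hU)
  · -- far partners at the classes of `T`
    intro a _ a' _ _
    refine ⟨fun T₂ hT₂ h12 => ?_, fun T₂ hT₂ h12 => ?_⟩
    · obtain ⟨⟨h3, h4⟩, -, -, -⟩ := hcfar T₂ hT₂ h12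
      exact far_of_inter_bounds c hc2 hcen T₀ T₂ m hn (hH T₂ hT₂) T hTm h3 h4 a a'
    · obtain ⟨-, ⟨h3, h4⟩, -, -⟩ := hcfar T₂ hT₂ h12
      exact far_of_inter_bounds c hc2 hcen T₁ T₂ m hn₁ (hH₁ T₂ hT₂ h12) _ hcW h3 h4 a a'
  · -- far partners at the classes of `T'` (companion frame)
    intro s _ s' _ _
    refine ⟨fun T₂ hT₂ h12 => ?_, fun T₂ hT₂ h12 => ?_⟩
    · obtain ⟨-, -, ⟨h3, h4⟩, -⟩ := hcfar T₂ hT₂ h12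
      exact far_of_inter_bounds c hc2 hcen T₀ T₂ m hn (hH T₂ hT₂) T' hTm' h3 h4 s s'
    · obtain ⟨-, -, -, ⟨h3, h4⟩⟩ := hcfar T₂ hT₂ h12
      exact far_of_inter_bounds c hc2 hcen (rt c c T₁) T₂ m hn₁c (hH₁c T₂ hT₂ h12) _ hcW' h3 h4 s s'

end

end Summit.HodgeConjecture.CorCM.Census.CentralSquares
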